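import Literature.NumberTheory.EllipticCurves.SwanConductorTorsionDichotomyProofs
import Literature.NumberTheory.EllipticCurves.OpenImageMazurProofs
import Literature.NumberTheory.EllipticCurves.OpenImageMazurCharacterProofs
import Literature.NumberTheory.EllipticCurves.SemistableModPImageReducibleProofs
import Literature.NumberTheory.GaloisRepresentations.ArtinConductorHasseArfDischargeProofs
import HarnessLib

/-!
# Crux `FreyModularity` (stmt-ABC-11340), line `Sketch`: the stub `stub_swanEvenOfStableLine`
# (Diamond–Kramer 1995, Lemma 3: a stable line in `E[5]` forces `Sw_𝔓(E[5])` to be even) — proved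

The registered stub `stub_swanEvenOfStableLine` of the line `Sketch` of the crux
`Summit.ABC.ABC.Theses.DefiniteXi.FreyModularity`: **for an elliptic curve `E/ℚ` whose `5`-torsion
`E[5]` contains a `Γ_ℚ`-stable subgroup `H` other than `0` and `E[5]`, the Swan conductor of the
Galois representation `E[5]` at every prime `𝔓` of `\bar ℤ` above `2` is an even natural number.**
This is Lemma 3 of F. Diamond, K. Kramer, *Modularity of a family of elliptic curves* (1995) — "the
wild conductor exponent `b` is integer-valued and additive on short exact sequences, so for a
reducible `ψ : I → GL₂(𝔽̄_ℓ)` with `det ψ` tame, `b(ψ) = 2 b(χ)` is even" — in the tree's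
vocabulary (item G09: `Sw_𝔓(ρ) = ∫₀^∞ codim M^{Γ_ℚ^u(𝔓)} du`, `GaloisRep.swanConductorAt`; the
`ℓ`-torsion as a `GaloisRep`, `WeierstrassCurve.torsionGaloisRep`).

**Proof.**  `H = 𝔽₅ P` is a line (`exists_eq_zmultiples_of_ne_bot_of_ne_top`) with isogeny
character `r : Γ_ℚ → 𝔽₅ˣ`, `σ P = r(σ) P` (`Mazur1978.exists_isogenyCharacter`), of open kernel
(`Mazur1978.isOpen_ker_of_smul_eq`).  For `u > 0` the wild group `Γ^u = Γ_ℚ^u(𝔓)` fixes `μ₅`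
and acts on `E[5]` through a `2`-group, so (the tree's
`forall_smul_geomTorsion_eq_of_smul_eq_of_ne_zero_of_mem_absUpperRamificationSubgroup`, the
content of `det ρ̄_{E,5} = χ̄₅`) it fixes `E[5]` pointwise as soon as it fixes `P`, i.e. as soon as
`r(Γ^u) = 1`; hence **`Γ^u` moves `E[5]` iff `r` is non-trivial on `Γ^u`**
(`exists_smul_geomTorsion_ne_iff_of_isogenyCharacter`).  With the dichotomy
`codim E[5]^{Γ^u} ∈ {0, 2}` (`codimFixed_torsionGaloisRep_absUpperRamificationSubgroup_eq_ite`)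
and the rank-one representation `χ` of `Γ_ℚ` on `𝔽₅` given by `r`
(`exists_galoisRep_character`; `codim 𝔽₅^{G} = [r(G) ≠ 1]`, `codimFixed_eq_ite_of_character`)
the integrands satisfy `codim E[5]^{Γ^u} = 2 · codim χ^{Γ^u}`, so `Sw_𝔓(E[5]) = 2 · Sw_𝔓(χ)`.
Finally `a_𝔓(χ) = codim χ^{I_𝔓} + Sw_𝔓(χ) ∈ ℕ` by the integrality of the Artin conductor of a
representation over `𝔽₅` (`2 ≠ 5`) whose inertia acts through a finite discrete quotient — the
tree's theorem `GaloisRep.exists_natCast_eq_artinConductorAt_of_hasOpenInertiaKerAt_holds` (Katz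
1988 Prop. 1.9, from Hasse–Arf, `hasseArf_holds`) — whence `Sw_𝔓(χ) ∈ ℕ` (`codim ∈ ℕ`,
`Sw ≥ 0`) and `Sw_𝔓(E[5]) = 2 · Sw_𝔓(χ)` is even.

Everything used is proved in the tree; no named-fact hypotheses, no definitions (the rank-one
representation of `r` is produced by an existence theorem).  All axioms `propext`,
`Classical.choice`, `Quot.sound`.

## References

* [DiamondKramer1995] F. Diamond, K. Kramer, *Modularity of a family of elliptic curves*,
  Math. Res. Lett. 2 (1995), 299–304, Lemma 3.
* [Katz1988] N. M. Katz, *Gauss Sums, Kloosterman Sums, and Monodromy Groups* (1988), Ch. 1,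
  1.1, Prop. 1.9.
* [SerreLocalFields1979] J.-P. Serre, *Local Fields*, GTM 67 (1979), Ch. IV §3, Ch. VI §2.
* [Mazur1978] B. Mazur, *Rational isogenies of prime degree*, Invent. Math. 44 (1978), §5
  (the isogeny character).
* [SilvermanATAEC1994] J. H. Silverman, *Advanced Topics in the Arithmetic of Elliptic Curves*,
  GTM 151 (1994), §IV.10 and proof of Thm. IV.11.1 (PDF p. 370).
-/

-- `Summit.<Summit>.<Problem>` is the mandated summit-side namespace (CONVENTIONS §2); for the
-- single-conjunct summit `ABC` the two coincide, so the duplicate `ABC.ABC` is deliberate.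
set_option linter.dupNamespace false

noncomputable section

open scoped NumberField Classical

open MeasureTheory Field IsDedekindDomain
open Literature.NumberTheory.EllipticCurves
open Literature.NumberTheory.GaloisRepresentations
open WeierstrassCurve

namespace Summit.ABC.ABC.Theorems

attribute [local instance] AddSubgroup.torsionBy.zmodModule

/-! ## The rank-one Galois representation of a character with open kernel -/

section Character

variable {K : Type*} [Field K] {A : Type*} [Field A] [TopologicalSpace A] [DiscreteTopology A]

/-- **The rank-one Galois representation of a character with open kernel.**  For a field `K`, a
discrete field `A` and a homomorphism `r : Γ_K → Aˣ` with open kernel, there is a continuous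
`A`-linear representation `χ` of `Γ_K` on `A` (item G09 `GaloisRep K A A`) with `χ(σ) x = r(σ) x`:
`σ ↦ r(σ)` is continuous (a homomorphism with open kernel is locally constant), hence so is
`(σ, x) ↦ r(σ) x`.  (Katz 1988, Ch. 1, 1.1: a representation with open kernel is continuous for
the discrete topology.) [folklore] -/
theorem exists_galoisRep_character (r : absoluteGaloisGroup K →* Aˣ)
    (hr : IsOpen ((r.ker : Subgroup (absoluteGaloisGroup K)) : Set (absoluteGaloisGroup K))) :
    ∃ χ : GaloisRep K A A, ∀ (σ : absoluteGaloisGroup K) (x : A), χ σ x = (r σ : A) * x := by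
  -- `σ ↦ (r σ : A)` is continuous: it is a homomorphism with open kernel
  set f : absoluteGaloisGroup K →* A := (Units.coeHom A).comp r with hf
  have hcont : Continuous f := by
    refine continuous_of_continuousAt_one f ?_
    rw [ContinuousAt, map_one]
    refine Filter.tendsto_def.mpr fun U hU ↦ Filter.mem_of_superset (hr.mem_nhds r.ker.one_mem) ?_
    intro x hx
    rw [Set.mem_preimage, hf, MonoidHom.comp_apply, (MonoidHom.mem_ker).mp hx, map_one]
    exact mem_of_mem_nhds hU
  -- the representation `σ ↦ (x ↦ r(σ) x)`
  let ρ : Representation A (absoluteGaloisGroup K) A :=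
    (algebraMap A (Module.End A A) : A →* Module.End A A).comp f
  refine ⟨⟨ρ, ?_⟩, fun σ x ↦ ?_⟩
  · change Continuous fun p : absoluteGaloisGroup K × A ↦ ρ p.1 p.2
    have : (fun p : absoluteGaloisGroup K × A ↦ ρ p.1 p.2) = fun p ↦ f p.1 * p.2 := by
      funext p
      simp [ρ, Module.algebraMap_end_apply]
    rw [this]
    exact (hcont.comp continuous_fst).mul continuous_snd
  · change ρ σ x = _
    simp [ρ, hf, Module.algebraMap_end_apply]

omit [DiscreteTopology A] in
/-- **`codim_A A^{G} = 0` if the character is trivial on `G`, `= 1` otherwise.**  For the rank-one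
representation `χ(σ) x = r(σ) x` of `Γ_K` on the field `A` and a subgroup `G ≤ Γ_K`: if
`r(G) = 1` then `G` acts trivially (`codimFixed_eq_zero_of_forall_eq_one`); if `r(σ) ≠ 1` for some
`σ ∈ G` then a fixed vector `x` has `(r(σ) - 1) x = 0`, so `x = 0`, the fixed space is `0` and its
codimension is `dim_A A = 1`.  (Serre, *Local Fields*, VI §2: for a character, `codim V^{G_i}` is
`0` or `1` according as `G_i ≤ ker` or not.) [folklore] -/
theorem codimFixed_eq_ite_of_character {r : absoluteGaloisGroup K →* Aˣ} {χ : GaloisRep K A A}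
    (hχ : ∀ (σ : absoluteGaloisGroup K) (x : A), χ σ x = (r σ : A) * x)
    (G : Subgroup (absoluteGaloisGroup K)) :
    χ.codimFixed G = if ∀ σ ∈ G, r σ = 1 then 0 else 1 := by
  split_ifs with h
  · exact ContinuousRep.codimFixed_eq_zero_of_forall_eq_one χ fun σ hσ ↦
      LinearMap.ext fun x ↦ by rw [hχ, h σ hσ, Units.val_one, one_mul, Module.End.one_apply]
  · push Not at h
    obtain ⟨σ, hσ, hrσ⟩ := h
    have hbot : χ.fixedSubmodule G = ⊥ := by
      rw [Submodule.eq_bot_iff]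
      intro x hx
      have hfix : χ σ x = x := (ContinuousRep.mem_fixedSubmodule_iff χ G x).mp hx σ hσ
      rw [hχ] at hfix
      have h0 : ((r σ : A) - 1) * x = 0 := by rw [sub_mul, one_mul, hfix, sub_self]
      rcases mul_eq_zero.mp h0 with h1 | h1
      · exact absurd (Units.val_eq_one.mp (sub_eq_zero.mp h1)) hrσ
      · exact h1
    rw [ContinuousRep.codimFixed_eq_finrank_sub, hbot, finrank_bot, Module.finrank_self]

end Character

/-! ## The wild groups move `E[ℓ]` iff the isogeny character is non-trivial on them -/

section Claim

variable {K : Type*} [Field K] [NumberField K] (W : WeierstrassCurve K) (ℓ : ℕ) [Fact ℓ.Prime]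

/-- **A wild ramification group moves `E[ℓ]` iff the isogeny character of a stable line is
non-trivial on it.**  For an elliptic curve `E/K` over a number field, a prime `ℓ`, a prime
`𝔓 ∣ v ∤ ℓ` of `\bar ℤ_K`, `u > 0`, and a point `P ≠ O` of `E[ℓ]` spanning a `Γ_K`-stable line with
isogeny character `r` (`σ P = r(σ) P`): `Γ_K^u(𝔓)` moves some point of `E[ℓ]` iff `r(σ) ≠ 1` for
some `σ ∈ Γ_K^u(𝔓)`.  (⇐) such a `σ` moves `P` (`P` has order `ℓ`,
`Mazur1978.eq_one_of_val_smul_eq`); (⇒) if `r(Γ^u) = 1` then `Γ^u` fixes `P ≠ O`, hence fixes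
`E[ℓ]` pointwise, because `Γ^u ≤ I_𝔓` fixes `μ_ℓ` and acts through a `p`-group, `p ≠ ℓ` — an
element with a non-zero fixed vector and trivial determinant `χ̄_ℓ` is unipotent of `p`-power
order, so trivial (the tree's
`forall_smul_geomTorsion_eq_of_smul_eq_of_ne_zero_of_mem_absUpperRamificationSubgroup`).  This
is the step "`det ψ = χ` restricted to wild inertia is trivial, so `ψ|_P ≃ (χ₁, *; 0, χ₁)` and `P`
acts trivially iff `χ₁|_P` does" of Diamond–Kramer's Lemma 3.
[cite: DiamondKramer1995, Lemma 3] -/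
theorem exists_smul_geomTorsion_ne_iff_of_isogenyCharacter [W.IsElliptic]
    {v : HeightOneSpectrum (𝓞 K)} (hℓ : (ℓ : 𝓞 K) ∉ v.asIdeal)
    {𝔓 : Ideal (absIntegers (𝓞 K) K)} (h𝔓 : 𝔓 ∈ v.primesAbove) {u : ℝ} (hu : 0 < u)
    {P : geomTorsion W ℓ} (hP0 : P ≠ 0) {r : absoluteGaloisGroup K →* (ZMod ℓ)ˣ}
    (hr : ∀ σ : absoluteGaloisGroup K, σ • P = ((r σ : (ZMod ℓ)ˣ) : ZMod ℓ).val • P) :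
    (∃ σ ∈ absUpperRamificationSubgroup (𝓞 K) 𝔓 u, ∃ T : geomTorsion W ℓ, σ • T ≠ T) ↔
      ¬ ∀ σ ∈ absUpperRamificationSubgroup (𝓞 K) 𝔓 u, r σ = 1 := by
  haveI : Fact (1 < ℓ) := ⟨(Fact.out : ℓ.Prime).one_lt⟩
  constructor
  · rintro ⟨σ, hσ, T, hT⟩ hall
    refine hT (W.forall_smul_geomTorsion_eq_of_smul_eq_of_ne_zero_of_mem_absUpperRamificationSubgroup
      ℓ hℓ h𝔓 hu hP0 (fun τ hτ ↦ ?_) σ hσ T)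
    rw [hr τ, hall τ hτ, Units.val_one, ZMod.val_one, one_smul]
  · intro h
    push Not at h
    obtain ⟨σ, hσ, hrσ⟩ := h
    refine ⟨σ, hσ, P, fun hfix ↦ hrσ (Units.ext ?_)⟩
    rw [hr σ] at hfix
    rw [Units.val_one]
    exact Mazur1978.eq_one_of_val_smul_eq W ℓ hP0 hfix

end Claim

/-! ## The stub: `Sw_𝔓(E[5])` is even along a stable line -/

/-- **Diamond–Kramer 1995, Lemma 3 (the registered stub `stub_swanEvenOfStableLine` of the line
`Sketch`).**  For an elliptic curve `E/ℚ`, a `Γ_ℚ`-stable subgroup `H` of `E[5]` other than `0` and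
`E[5]`, a place `v ∋ 2` of `𝓞 ℚ` and a prime `𝔓 ∣ v` of `\bar ℤ`: the Swan conductor of the
Galois representation `E[5]` at `𝔓` is `2n` for some `n ∈ ℕ`.  Proof: `H = 𝔽₅ P`
(`exists_eq_zmultiples_of_ne_bot_of_ne_top`) with isogeny character `r`
(`Mazur1978.exists_isogenyCharacter`, open kernel `Mazur1978.isOpen_ker_of_smul_eq`); for `u > 0`,
`codim E[5]^{Γ^u} = 2 · [Γ^u moves E[5]]` (`codimFixed_torsionGaloisRep_absUpperRamificationSubgroup_eq_ite`,
`5 ∉ v` as `2 ∈ v`) `= 2 · [r(Γ^u) ≠ 1]` (`exists_smul_geomTorsion_ne_iff_of_isogenyCharacter`)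
`= 2 · codim χ^{Γ^u}` for the rank-one representation `χ` of `r` over `𝔽₅`
(`exists_galoisRep_character`, `codimFixed_eq_ite_of_character`), so `Sw_𝔓(E[5]) = 2 Sw_𝔓(χ)`;
and `Sw_𝔓(χ) = a_𝔓(χ) - codim χ^{I_𝔓} ∈ ℕ` because `a_𝔓(χ) ∈ ℕ`
(`GaloisRep.exists_natCast_eq_artinConductorAt_of_hasOpenInertiaKerAt_holds`: coefficients `𝔽₅`
with `q_v = 2^m ≠ 0` in `𝔽₅`, inertia acting through the finite discrete quotient `Γ_ℚ / ker r`;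
Katz 1.9 from Hasse–Arf) and `Sw_𝔓(χ) ≥ 0` (`swanConductorAt_nonneg`).
[cite: DiamondKramer1995, Lemma 3] -/
theorem stub_swanEvenOfStableLine :
    ∀ (W : WeierstrassCurve ℚ) [W.IsElliptic] (H : AddSubgroup (geomTorsion W (5 : ℕ))),
      (∀ σ : Field.absoluteGaloisGroup ℚ, ∀ P ∈ H, σ • P ∈ H) → H ≠ ⊥ → H ≠ ⊤ →
      ∀ (v : HeightOneSpectrum (𝓞 ℚ)), (2 : 𝓞 ℚ) ∈ v.asIdeal →
      ∀ 𝔓 ∈ v.primesAbove, ∃ n : ℕ, (W.torsionGaloisRep 5).swanConductorAt (𝓞 ℚ) 𝔓 = 2 * n := by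
  intro W _ H hst hbot htop v h2 𝔓 h𝔓
  haveI : Fact (Nat.Prime 5) := ⟨Nat.prime_five⟩
  -- `5 ∉ v` since `2 ∈ v`
  have h5 : ((5 : ℕ) : 𝓞 ℚ) ∉ v.asIdeal := by
    intro h5
    apply v.isPrime.ne_top
    rw [Ideal.eq_top_iff_one]
    have h1 : (1 : 𝓞 ℚ) = ((5 : ℕ) : 𝓞 ℚ) - 2 * 2 := by norm_num
    rw [h1]
    exact Ideal.sub_mem _ h5 (Ideal.mul_mem_left _ _ h2)
  -- the stable line `H = 𝔽₅ P` and its isogeny character `r`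
  obtain ⟨P, hPH, hP0, hHP⟩ := W.exists_eq_zmultiples_of_ne_bot_of_ne_top 5 H hbot htop
  have hstP : ∀ σ : absoluteGaloisGroup ℚ, σ • P ∈ AddSubgroup.zmultiples P := fun σ ↦
    hHP ▸ hst σ P hPH
  obtain ⟨r, hr⟩ := Mazur1978.exists_isogenyCharacter W 5 hP0 hstP
  have hker : IsOpen ((r.ker : Subgroup (absoluteGaloisGroup ℚ)) : Set (absoluteGaloisGroup ℚ)) :=
    Mazur1978.isOpen_ker_of_smul_eq W 5 hP0 hr
  -- the rank-one Galois representation `χ` of `r` over `𝔽₅`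
  obtain ⟨χ, hχ⟩ := exists_galoisRep_character (K := ℚ) (A := ZMod 5) r hker
  -- `Sw_𝔓(E[5]) = 2 · Sw_𝔓(χ)`: the integrands agree on `u > 0`
  have hSw : (W.torsionGaloisRep 5).swanConductorAt (𝓞 ℚ) 𝔓 =
      2 * χ.swanConductorAt (𝓞 ℚ) 𝔓 := by
    rw [GaloisRep.swanConductorAt_def, GaloisRep.swanConductorAt_def, ← integral_const_mul]
    refine setIntegral_congr_fun measurableSet_Ioi fun u hu ↦ ?_
    rw [Set.mem_Ioi] at hu
    rw [W.codimFixed_torsionGaloisRep_absUpperRamificationSubgroup_eq_ite 5 h5 h𝔓 hu,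
      exists_smul_geomTorsion_ne_iff_of_isogenyCharacter W 5 h5 h𝔓 hu hP0 hr,
      codimFixed_eq_ite_of_character hχ]
    split_ifs <;> norm_num
  -- `a_𝔓(χ) ∈ ℕ` (Artin–Katz integrality over `𝔽₅`, `q_v = 2^m`), hence `Sw_𝔓(χ) ∈ ℕ`
  have hchar : (v.residueCard : ZMod 5) ≠ 0 := by
    obtain ⟨p, hp, hpv, m, hm⟩ : ∃ p : ℕ, p.Prime ∧ (p : 𝓞 ℚ) ∈ v.asIdeal ∧
        ∃ m : ℕ, v.residueCard = p ^ m := by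
      haveI : Finite (𝓞 ℚ ⧸ v.asIdeal) := v.asIdeal.finiteQuotientOfFreeOfNeBot v.ne_bot
      letI : Fintype (𝓞 ℚ ⧸ v.asIdeal) := Fintype.ofFinite _
      haveI := v.isMaximal
      letI : Field (𝓞 ℚ ⧸ v.asIdeal) := Ideal.Quotient.field v.asIdeal
      obtain ⟨p, hc, m, hp, hcard⟩ := FiniteField.card' (𝓞 ℚ ⧸ v.asIdeal)
      refine ⟨p, hp, ?_, m, ?_⟩
      · rw [← Ideal.Quotient.eq_zero_iff_mem, map_natCast]
        exact CharP.cast_eq_zero _ p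
      · rw [HeightOneSpectrum.residueCard_eq_card_quotient, Nat.card_eq_fintype_card, hcard]
    have hp5 : p ≠ 5 := by
      rintro rfl
      exact h5 hpv
    have hp0 : (p : ZMod 5) ≠ 0 := by
      rw [Ne, ZMod.natCast_eq_zero_iff]
      exact fun hdvd ↦ hp5 ((Nat.prime_dvd_prime_iff_eq Nat.prime_five hp).mp hdvd).symm
    rw [hm, Nat.cast_pow]
    exact pow_ne_zero _ hp0
  have hopen : χ.HasOpenInertiaKerAt (𝓞 ℚ) 𝔓 :=
    ⟨r.ker, hker, fun σ hσ _ ↦ LinearMap.ext fun x ↦ by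
      rw [hχ, (MonoidHom.mem_ker).mp hσ, Units.val_one, one_mul, Module.End.one_apply]⟩
  obtain ⟨n, hn⟩ :=
    GaloisRep.exists_natCast_eq_artinConductorAt_of_hasOpenInertiaKerAt_holds h𝔓 χ hchar hopen
  rw [GaloisRep.artinConductorAt_def] at hn
  set m := χ.codimFixed (𝔓.inertia (absoluteGaloisGroup ℚ)) with hm
  have hnonneg := χ.swanConductorAt_nonneg (R := 𝓞 ℚ) 𝔓
  have hmn : (m : ℝ) ≤ n := by linarith
  have hmn' : m ≤ n := by exact_mod_cast hmn
  refine ⟨n - m, ?_⟩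
  rw [hSw, Nat.cast_sub hmn']
  linarith

end Summit.ABC.ABC.Theorems

end
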